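import Summits.QuantumAdvantage.AdviceFreeQNC0.WalkFailFloor
import HarnessLib

/-!
# Cell qa-qnc0 (rung F-Q1, route RingFrame, crux α `RingToElim`): coefficients of the walk
# characters — the closed form of `u^T · χ_a`, selector coefficients are bits, the strategy
# function

Second layer of the `𝔽₄`-character toolkit of `WalkCharacters.lean` / `WalkExactLaw.lean`
(planner qa-qnc0-p1 TARGET §15.1), used by the RING PHASE LAW (`WalkPhaseLaw.lean`):

* `Lfun_add_apply`, `Lfun_mul_apply`, `Lfun_sum_apply` — linearity of the coefficient
  functional `L_a`;
* `flipOn` (`σ_S a`), `lettSum` (`a(T) = Σ_{i∈T} aᵢ`), `misSet` (mismatch set, `|mis| = pdist`);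
* **`monoF_mul_chi`** — the CLOSED FORM of the multiplication rule:
  `u^T · χ_a = ω^{a(T)} · Σ_{S ⊆ T} χ_{σ_S a}` (TARGET §15.1: "the transform of `u^T χ_a` is a
  unit times the indicator of the subcube `C(a,T)`"); hence **`Lfun_monoF_mul_chi`**:
  `L_c(u^T · χ_a) = ω^{a(T)} · [mis(a,c) ⊆ T]`;
* **`Lfun_lowDeg_mul_chi`** — for an `𝔽₂`-polynomial `F` of degree `≤ D` (read in `𝔽₄`) and a
  pattern `c` at Hamming distance `≥ D` from `a`, `L_c(F · χ_a) = b · [dist(a,c) ≤ D] ·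
  ω^{a(mis(a,c))}` for a BIT `b ∈ 𝔽₂` (only the top monomial `u^{mis(a,c)}` of `F` reaches `c`,
  with an `𝔽₂`-coefficient);
* `stratFun c y = Σ_g [yᵍ]·ω^{c+g+|u|+|u_{<g}|}` — a walk strategy with charge `c` as an
  `𝔽₄`-valued function: `tr_stratFun` (`tr f = [WIN]`, from `iotaF_ringWinU`), `stratFun_eq`
  (`f = Σ_g ω^{c+g}·yᵍχ_{a^{(g)}}`), `stratFun_mem_fullSpan` (`f ∈ M_D(P)`).

The cell's lemmas (planner qa-qnc0-p1 gen 3, TARGET §15.1; prover qn-prover-3 gen 6), 2026-08-27;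
standard character calculus, not in print in this form.  WHAT THIS IS NOT: no statement about
the game (see `WalkPhaseLaw.lean`); no separation claim.
-/

noncomputable section

namespace Summit.QuantumAdvantage.AdviceFreeQNC0

open Finset
open Literature.Computability.MetaComplexity Literature.Computability.MetaComplexity.Smolensky
open F4

variable {m : ℕ}


/-! ### Linearity of the coefficient functional -/

/-- `L_a` is additive. -/
theorem Lfun_add_apply (a : Fin m → Bool) (f g : (Fin m → Bool) → F4) :
    Lfun a (fun u => f u + g u) = Lfun a f + Lfun a g := by
  unfold Lfun
  rw [← Finset.sum_add_distrib]
  exact Finset.sum_congr rfl fun u _ => by rw [add_mul]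

/-- `L_a` is homogeneous. -/
theorem Lfun_mul_apply (a : Fin m → Bool) (r : F4) (f : (Fin m → Bool) → F4) :
    Lfun a (fun u => r * f u) = r * Lfun a f := by
  unfold Lfun
  rw [Finset.mul_sum]
  exact Finset.sum_congr rfl fun u _ => by rw [mul_assoc]

/-- `L_a` of a finite sum of functions. -/
theorem Lfun_sum_apply {ι : Type*} (a : Fin m → Bool) (s : Finset ι)
    (f : ι → (Fin m → Bool) → F4) :
    Lfun a (fun u => ∑ i ∈ s, f i u) = ∑ i ∈ s, Lfun a (f i) := by
  classical
  induction s using Finset.induction_on with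
  | empty => simp [Lfun]
  | insert j s hj ih =>
    calc Lfun a (fun u => ∑ i ∈ insert j s, f i u)
        = Lfun a (fun u => f j u + (fun u => ∑ i ∈ s, f i u) u) :=
          congrArg (Lfun a) (funext fun u => Finset.sum_insert hj)
      _ = Lfun a (f j) + Lfun a (fun u => ∑ i ∈ s, f i u) := Lfun_add_apply a (f j) _
      _ = ∑ i ∈ insert j s, Lfun a (f i) := by rw [ih, Finset.sum_insert hj]

/-! ### Letter flips, mismatch sets, and the closed form of `u^T · χ_a` -/

/-- Flip the letters of the pattern `a` on the set `S` (`σ_S a`). -/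
def flipOn (S : Finset (Fin m)) (a : Fin m → Bool) : Fin m → Bool :=
  fun i => if i ∈ S then !a i else a i

/-- The letter sum `a(T) = Σ_{i ∈ T} aᵢ` (letters `1, 2`). -/
def lettSum (T : Finset (Fin m)) (a : Fin m → Bool) : ℕ := ∑ i ∈ T, lett (a i)

/-- The mismatch set of two patterns (its cardinality is `pdist`). -/
def misSet (a b : Fin m → Bool) : Finset (Fin m) := univ.filter fun i => a i ≠ b i

/-- `|mis(a,b)| = dist(a,b)`. -/
theorem card_misSet (a b : Fin m → Bool) : (misSet a b).card = pdist a b := rfl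

/-- Flipping nothing. -/
theorem flipOn_empty (a : Fin m → Bool) : flipOn ∅ a = a := by
  funext i
  simp [flipOn]

/-- Flipping one more letter. -/
theorem flipOn_insert {S : Finset (Fin m)} {i : Fin m} (hi : i ∉ S) (a : Fin m → Bool) :
    flipOn (insert i S) a = Function.update (flipOn S a) i (!(flipOn S a) i) := by
  classical
  funext j
  by_cases hj : j = i
  · subst hj
    rw [Function.update_self]
    simp [flipOn, hi]
  · rw [Function.update_of_ne hj]
    simp [flipOn, hj]

/-- `σ_S a = c` exactly when `S` is the mismatch set of `a` and `c`. -/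
theorem flipOn_eq_iff (S : Finset (Fin m)) (a c : Fin m → Bool) :
    flipOn S a = c ↔ S = misSet a c := by
  classical
  constructor
  · rintro rfl
    ext i
    simp only [misSet, Finset.mem_filter, Finset.mem_univ, true_and, flipOn]
    by_cases h : i ∈ S
    · simp [h]
    · simp [h]
  · rintro rfl
    funext i
    simp only [flipOn, misSet, Finset.mem_filter, Finset.mem_univ, true_and]
    cases a i <;> cases c i <;> simp

/-- The letter sum of `insert i T`. -/
theorem lettSum_insert {T : Finset (Fin m)} {i : Fin m} (hi : i ∉ T) (a : Fin m → Bool) :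
    lettSum (insert i T) a = lett (a i) + lettSum T a := by
  unfold lettSum
  rw [Finset.sum_insert hi]

/-- **Closed form of the multiplication rule**: `u^T · χ_a(u) = ω^{a(T)} · Σ_{S ⊆ T} χ_{σ_S a}(u)`.
[folklore] -/
theorem monoF_mul_chi (T : Finset (Fin m)) (a : Fin m → Bool) (u : Fin m → Bool) :
    monoF T u * chi a u = ω ^ lettSum T a * ∑ S ∈ T.powerset, chi (flipOn S a) u := by
  classical
  induction T using Finset.induction_on with
  | empty => simp [monoF, lettSum, flipOn_empty]
  | insert i T hi ih =>
    have key : ∀ S ∈ T.powerset, ιF (u i) * chi (flipOn S a) u =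
        ω ^ lett (a i) * (chi (flipOn S a) u + chi (flipOn (insert i S) a) u) := by
      intro S hS
      have hiS : i ∉ S := fun h => hi (Finset.mem_powerset.1 hS h)
      have hai : flipOn S a i = a i := by simp [flipOn, hiS]
      rw [ind_mul_chi, flipOn_insert hiS, hai]
    calc monoF (insert i T) u * chi a u
        = ιF (u i) * (monoF T u * chi a u) := by
          unfold monoF; rw [Finset.prod_insert hi, mul_assoc]
      _ = ιF (u i) * (ω ^ lettSum T a * ∑ S ∈ T.powerset, chi (flipOn S a) u) := by rw [ih]
      _ = ω ^ lettSum T a * ∑ S ∈ T.powerset, ιF (u i) * chi (flipOn S a) u := by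
          rw [mul_left_comm, Finset.mul_sum]
      _ = ω ^ lettSum T a * ∑ S ∈ T.powerset,
            ω ^ lett (a i) * (chi (flipOn S a) u + chi (flipOn (insert i S) a) u) := by
          rw [Finset.sum_congr rfl key]
      _ = ω ^ lettSum (insert i T) a *
            (∑ S ∈ T.powerset, chi (flipOn S a) u + ∑ S ∈ T.powerset, chi (flipOn (insert i S) a) u) := by
          rw [← Finset.mul_sum, Finset.sum_add_distrib, lettSum_insert hi, pow_add]
          ring
      _ = ω ^ lettSum (insert i T) a * ∑ S ∈ (insert i T).powerset, chi (flipOn S a) u := by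
          rw [Finset.sum_powerset_insert hi]

/-- **The coefficients of `u^T · χ_a`**: `L_c(u^T χ_a) = ω^{a(T)} · [mis(a,c) ⊆ T]`. [folklore] -/
theorem Lfun_monoF_mul_chi (c a : Fin m → Bool) (T : Finset (Fin m)) :
    Lfun c (fun u => monoF T u * chi a u) = if misSet a c ⊆ T then ω ^ lettSum T a else 0 := by
  classical
  have e : (fun u => monoF T u * chi a u) =
      fun u => ω ^ lettSum T a * (fun u => ∑ S ∈ T.powerset, (fun S u => chi (flipOn S a) u) S u) u :=
    funext fun u => monoF_mul_chi T a u
  rw [e, Lfun_mul_apply, Lfun_sum_apply]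
  have h1 : ∀ S ∈ T.powerset, Lfun c ((fun S u => chi (flipOn S a) u) S) =
      if S = misSet a c then 1 else 0 := by
    intro S _
    show Lfun c (chi (flipOn S a)) = _
    rw [Lfun_chi]
    by_cases h : S = misSet a c
    · rw [if_pos h, if_pos ((flipOn_eq_iff S a c).2 h).symm]
    · rw [if_neg h, if_neg fun h' => h ((flipOn_eq_iff S a c).1 h'.symm)]
  rw [Finset.sum_congr rfl h1, Finset.sum_ite_eq' T.powerset (misSet a c) fun _ => (1 : F4)]
  by_cases hsub : misSet a c ⊆ T
  · rw [if_pos (Finset.mem_powerset.2 hsub), if_pos hsub, mul_one]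
  · rw [if_neg (fun h => hsub (Finset.mem_powerset.1 h)), if_neg hsub, mul_zero]

/-! ### `𝔽₂`-selectors: the coefficient at a pattern at distance `≥ D` is a bit -/

/-- The transfer `𝔽₂ → 𝔽₄` of a monomial. -/
private theorem algebraMap_mono (S : Finset (Fin m)) (u : Fin m → Bool) :
    algebraMap (ZMod 2) F4 (mono (ZMod 2) S u) = monoF S u := by
  unfold mono monoF ιF
  rw [map_prod]
  refine Finset.prod_congr rfl fun i _ => ?_
  by_cases h : u i = true <;> simp [h]

/-- **Selector coefficients are bits.**  For `F` of `𝔽₂`-degree `≤ D` and a pattern `c` at Hamming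
distance `≥ D` from `a`: `L_c(F · χ_a) = b · [dist(a,c) ≤ D] · ω^{a(mis(a,c))}` for a bit `b ∈ 𝔽₂`
(only the monomial `u^{mis(a,c)}` of `F` reaches `c`). [folklore] -/
theorem Lfun_lowDeg_mul_chi {D : ℕ} (c a : Fin m → Bool) (hD : D ≤ pdist a c)
    {F : CubeFn (ZMod 2) m} (hF : F ∈ lowDeg (ZMod 2) m D) :
    ∃ b : ZMod 2, Lfun c (fun u => algebraMap (ZMod 2) F4 (F u) * chi a u) =
      algebraMap (ZMod 2) F4 b *
        (if pdist a c ≤ D then ω ^ lettSum (misSet a c) a else 0) := by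
  classical
  rw [lowDeg_eq_span] at hF
  induction hF using Submodule.span_induction with
  | mem G hG =>
    obtain ⟨⟨S, hS⟩, rfl⟩ := hG
    have e : (fun u => algebraMap (ZMod 2) F4 (mono (ZMod 2) S u) * chi a u) =
        fun u => monoF S u * chi a u := by
      funext u; rw [algebraMap_mono]
    rw [e, Lfun_monoF_mul_chi]
    by_cases hsub : misSet a c ⊆ S
    · have heq : misSet a c = S :=
        Finset.eq_of_subset_of_card_le hsub (by rw [card_misSet]; omega)
      refine ⟨1, ?_⟩
      have hle : pdist a c ≤ D := by rw [← card_misSet, heq]; exact hS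
      rw [if_pos hsub, map_one, one_mul, if_pos hle, heq]
    · exact ⟨0, by rw [if_neg hsub, map_zero, zero_mul]⟩
  | zero =>
    refine ⟨0, ?_⟩
    rw [map_zero, zero_mul]
    simp [Lfun]
  | add G H _ _ hG hH =>
    obtain ⟨b₁, h₁⟩ := hG
    obtain ⟨b₂, h₂⟩ := hH
    refine ⟨b₁ + b₂, ?_⟩
    have e : (fun u => algebraMap (ZMod 2) F4 ((G + H) u) * chi a u) =
        fun u => algebraMap (ZMod 2) F4 (G u) * chi a u +
          (fun u => algebraMap (ZMod 2) F4 (H u) * chi a u) u := by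
      funext u; simp [add_mul]
    rw [e, Lfun_add_apply, h₁, h₂, map_add, add_mul]
  | smul r G _ hG =>
    obtain ⟨b, hb⟩ := hG
    refine ⟨r * b, ?_⟩
    have e : (fun u => algebraMap (ZMod 2) F4 ((r • G) u) * chi a u) =
        fun u => algebraMap (ZMod 2) F4 r * (fun u => algebraMap (ZMod 2) F4 (G u) * chi a u) u := by
      funext u; simp [smul_eq_mul, mul_assoc]
    rw [e, Lfun_mul_apply, hb, map_mul, mul_assoc]

/-! ### The strategy as an element of the full module -/

variable {n : ℕ}

/-- The walk strategy `y` with charge `c` as an `𝔽₄`-valued function: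
`f(u) = Σ_g [yᵍ(u)]·ω^{c + g + |u| + |u_{<g}|}`. -/
def stratFun (c : ℕ) (y : Fin (n + 1) → (Fin n → Bool) → Bool) (u : Fin n → Bool) : F4 :=
  ∑ g : Fin (n + 1), ιF (y g u) * ω ^ (c + g.val + walkExp u g.val)

/-- `tr f = [WIN]`. -/
theorem tr_stratFun (c : ℕ) (y : Fin (n + 1) → (Fin n → Bool) → Bool) (u : Fin n → Bool) :
    tr (stratFun c y u) = ιF (ringWinU c y u) := by
  unfold stratFun
  rw [iotaF_ringWinU]

/-- `f = Σ_g ω^{c+g} · (yᵍ χ_{a^{(g)}})`. -/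
theorem stratFun_eq (c : ℕ) (y : Fin (n + 1) → (Fin n → Bool) → Bool) :
    stratFun c y = fun u => ∑ g : Fin (n + 1), ω ^ (c + g.val) * (ιF (y g u) * chi (aPat g.val) u) := by
  funext u
  unfold stratFun
  refine Finset.sum_congr rfl fun g _ => ?_
  rw [pow_add, omega_pow_walkExp]
  ring

/-- The strategy function of a degree-`D` strategy lies in the full module `M_D(P)`. -/
theorem stratFun_mem_fullSpan {D : ℕ} (c : ℕ) (y : Fin (n + 1) → (Fin n → Bool) → Bool)
    (hy : ∀ g, HasDeg (y g) D) : stratFun c y ∈ fullSpan n D := by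
  rw [stratFun_eq]
  have e : (fun u => ∑ g : Fin (n + 1), ω ^ (c + g.val) * (ιF (y g u) * chi (aPat g.val) u)) =
      ∑ g : Fin (n + 1), (ω ^ (c + g.val) • fun u => ιF (y g u) * chi (aPat g.val) u) := by
    funext u
    simp only [Finset.sum_apply, Pi.smul_apply, smul_eq_mul]
  rw [e]
  exact Submodule.sum_mem _ fun g _ =>
    Submodule.smul_mem _ _ (polySpan_mul_chi_mem (iotaF_mem_polySpan (hy g)) g.val)

end Summit.QuantumAdvantage.AdviceFreeQNC0

end
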